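import Literature.Geometry.Lorentzian.CommonDevelopmentSymm
import Literature.Geometry.Lorentzian.SubdevelopmentCausalConvexity
import Literature.Geometry.Lorentzian.RelativeDevelopmentGluingCauchy
import HarnessLib

/-!
# Corresponding boundary points of a common development, I: symmetry and the first step of
# Sbierski 2016, Prop. 13

J. Sbierski, Ann. Henri Poincaré 17 (2016) 301–329 = arXiv:1309.7591v3, §3.2, Proposition 13
(*"EquivCha"*): for a common globally hyperbolic development `U ⊆ M` of the developments `M`, `M'`
with isometric embedding `ψ`, and `p ∈ ∂U`, `p' ∈ ∂ψ(U)`: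

> *(i)* `p`, `p'` are corresponding boundary points *⇒ (ii)* if `γ : (−ε, 0) → U` is a timelike
> curve with `lim_{s ↗ 0} γ(s) = p`, then `lim_{s ↗ 0} (ψ ∘ γ)(s) = p'`. … *In particular it
> follows from (ii) and (iii) that `p ∈ ∂U` has at most one corresponding boundary point.*

The printed proof (p. 13 of the arXiv version) uses: the openness of `≪`, the closedness of `≤`
and the strong causality condition of the globally hyperbolic `M'`, push-up (O'Neill's Cor. 14.1),
and — tacitly — the causal convexity of `U ⊆ M` and of `ψ(U) ⊆ M'`
(`SubdevelopmentCausalConvexity`, `CommonDevelopmentSymm`) and the symmetry `M ↔ M'` (*"The other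
inclusion follows by symmetry"*; `CommonDevelopment.symm`). Over the tree's Cauchy developments
the global-hyperbolicity consequences are not yet theorems (the wanted fact "a Cauchy hypersurface
makes the spacetime globally hyperbolic" and the named fact `GlobalHyperbolicityStrongCausality`),
so they enter as DISPLAYED hypotheses in their weakest used form: closedness of the causal futures
of points (`hJ`, `hJ'`) and strong causality of `M'` (`hSC'`).

* `LorentzianMetric.mem_chronologicalFuture_of_mem_chronologicalFuture_of_mem_causalFuture` — the
  second push-up `x ≪ y ≤ z ⇒ x ≪ z` (time dual of `mem_chronologicalFuture_of_mem_causalFuture`);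
* `LorentzianMetric.IsStronglyCausal.exists_nhds_chronologicalDiamond_subset` — the footnote of
  the printed proof: strong causality at `p'` gives `W' ∋ p'` with `I⁺(q') ∩ I⁻(p') ⊆ V'` for all
  `q' ∈ W'` (splicing a timelike curve `q' → x → p'`, `exists_isFutureTimelikeCurveOn_splice`);
* `CommonDevelopment.map_mem_chronologicalFuture_map` — `ψ` carries `≪` between points of `U`
  (the connecting timelike curve stays in `U` by causal convexity);
* `CommonDevelopment.IsCorrespondingPair.symm` — corresponding pairs of `(U, ψ)` are corresponding
  pairs of `(ψ(U), ψ⁻¹)`;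
* `CommonDevelopment.IsCorrespondingPair.mem_chronologicalFuture_map` — **Sbierski's first step**
  `ψ(I⁻(p) ∩ U) ⊆ I⁻(p')`: `q ∈ U`, `q ≪ p` ⇒ `ψ q ≪ p'`;
* the limit statements themselves (Prop. 13 (i) ⇒ (ii), (iii) ⇒ (i), uniqueness of the
  corresponding point) are in the sequel `CorrespondingBoundaryLimit`.

Everything is proved; no definitions, no named facts (D-0026).

## References

* J. Sbierski, Ann. Henri Poincaré 17 (2016) 301–329 = arXiv:1309.7591v3, §3.2, Def. 11 and
  Prop. 13 with its proof and footnotes (arXiv numbering). [Sbierski2016AHP]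
* B. O'Neill, *Semi-Riemannian geometry with applications to relativity*, Academic Press 1983,
  Ch. 14, Lemma 14.3, Cor. 14.1, Lemma 14.22, p. 437 (strong causality). [ONeillSemiRiemannian1983]
-/

noncomputable section

open Bundle Set Function Filter TopologicalSpace Topology Manifold
open scoped Manifold ContDiff Topology

namespace Literature.Geometry.Lorentzian

universe u

/-! ### Two lemmas of general causality theory -/

section General

variable {E : Type*} [NormedAddCommGroup E] [NormedSpace ℝ E] {H : Type*} [TopologicalSpace H]
  {I : ModelWithCorners ℝ E H} {n : ℕ∞ω} {M : Type*} [TopologicalSpace M] [ChartedSpace H M]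
  [IsManifold I ∞ M]

namespace LorentzianMetric

variable {g : LorentzianMetric I n M} {τ : TimeOrientation g}

/-- **Push-up, second form: `x ≪ y ≤ z ⇒ x ≪ z`** (time dual of
`mem_chronologicalFuture_of_mem_causalFuture`). O'Neill 1983, Ch. 14, Cor. 14.1 (p. 402: "If
`x ≪ y` and `y ≤ z` … then `x ≪ z`"). [cite: ONeillSemiRiemannian1983, Ch. 14, Cor. 14.1 (p. 402)] -/
theorem mem_chronologicalFuture_of_mem_chronologicalFuture_of_mem_causalFuture
    [BoundarylessManifold I M] [FiniteDimensional ℝ E] (hn : 1 ≤ n) {x y z : M}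
    (hy : y ∈ g.chronologicalFuture τ {x}) (hz : z ∈ g.causalFuture τ {y}) :
    z ∈ g.chronologicalFuture τ {x} := by
  -- read everything with the reversed time orientation: `z ≥ y ≫ x`
  have hy' : y ∈ g.causalFuture τ.reverse {z} := mem_causalPast_singleton_iff.2 hz
  have hx' : x ∈ g.chronologicalFuture τ.reverse {y} := mem_chronologicalPast_of_mem_chronologicalFuture hy
  exact mem_chronologicalFuture_of_mem_chronologicalPast
    (mem_chronologicalFuture_of_mem_causalFuture (τ := τ.reverse) hn hy' hx')

/-- **The strong-causality box** (footnote to the proof of Prop. 13 of Sbierski 2016): if the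
strong causality condition holds, every neighbourhood `V` of `p` contains a neighbourhood `W` of
`p` such that `I⁺(q) ∩ I⁻(p) ⊆ V` for every `q ∈ W` — a timelike curve from `q` to `p` through a
point `x` (spliced from `q ≪ x ≪ p`, `exists_isFutureTimelikeCurveOn_splice`) has its endpoints in
`W`, hence stays in `V`. [cite: Sbierski2016AHP, §3.2, proof of Prop. 13 (footnote on strong causality)] -/
theorem IsStronglyCausal.exists_nhds_chronologicalDiamond_subset (hSC : g.IsStronglyCausal τ)
    (p : M) {V : Set M} (hV : V ∈ 𝓝 p) :
    ∃ W ∈ 𝓝 p, W ⊆ V ∧ ∀ q ∈ W,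
      g.chronologicalFuture τ {q} ∩ g.chronologicalPast τ {p} ⊆ V := by
  obtain ⟨W, hW, hWV, hbox⟩ := hSC p V hV
  refine ⟨W, hW, hWV, fun q hq x hx ↦ ?_⟩
  obtain ⟨hqx, hxp⟩ := hx
  obtain ⟨q₀, hq₀, γ₁, a₁, b₁, hab₁, hγ₁, hγ₁a, hγ₁b⟩ := hqx
  rw [mem_singleton_iff] at hq₀
  subst hq₀
  obtain ⟨x₀, hx₀, γ₂, a₂, b₂, hab₂, hγ₂, hγ₂a, hγ₂b⟩ :=
    mem_chronologicalFuture_of_mem_chronologicalPast hxp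
  rw [mem_singleton_iff] at hx₀
  subst hx₀
  obtain ⟨γ, L, c, hL, h₁, h₂, hγ, hγleft, hγright⟩ :=
    exists_isFutureTimelikeCurveOn_splice hab₁ hγ₁ hγ₁b hab₂ hγ₂ hγ₂a
  have hend : a₁ < b₂ - c := by linarith
  have hγa : γ a₁ = γ₁ a₁ := hγleft a₁ hab₁.le
  have hγb : γ (b₂ - c) = γ₂ b₂ := by
    rw [hγright (b₂ - c) (by linarith)]
    congr 1
    ring
  have hmem := hbox γ a₁ (b₂ - c) hend hγ.isFutureCausalCurveOn (by rw [hγa, hγ₁a]; exact hq)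
    (by rw [hγb, hγ₂b]; exact mem_of_mem_nhds hW) b₁ ⟨hab₁.le, by linarith⟩
  rwa [hγleft b₁ le_rfl, hγ₁b] at hmem

end LorentzianMetric

end General

/-! ### Corresponding boundary points of a common globally hyperbolic development -/

section Developments

variable {k : ℕ} {X : Type u} [TopologicalSpace X] [ChartedSpace (EuclideanSpace ℝ (Fin k)) X]
  [IsManifold (𝓡 k) ∞ X] [ConnectedSpace X] {D : InitialDataSet (𝓡 k) X}

namespace CauchyDevelopment.CommonDevelopment

variable {𝒟 𝒟' : CauchyDevelopment D} (𝔠 : CommonDevelopment 𝒟 𝒟')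

/-- **`ψ` carries `≪` between points of `U`**: if `x ≪ y` in `M` with `x, y ∈ U`, then
`ψ x ≪ ψ y` in `M'` — the timelike curve of `M` from `x` to `y` lies in `U` by causal convexity
(`mem_opens_of_isFutureCausalCurveOn`, `SubdevelopmentCausalConvexity`) and is carried by the
time-orientation preserving isometric immersion `ψ` to a timelike curve of `M'`
(`IsFutureTimelikeCurveOn.comp_isIsometricImmersion`, `RelativeDevelopmentGluingCauchy`). Tacit in Sbierski
2016, §3.2, proof of Prop. 13 ("`ψ(q) ≪ r'₁`"). [cite: Sbierski2016AHP, §3.2, proof of Prop. 13 (arXiv numbering)] -/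
theorem map_mem_chronologicalFuture_map {x y : 𝔠.opens}
    (h : (y : 𝒟.carrier) ∈ 𝒟.metric.chronologicalFuture 𝒟.timeOrientation {(x : 𝒟.carrier)}) :
    𝔠.map y ∈ 𝒟'.metric.chronologicalFuture 𝒟'.timeOrientation {𝔠.map x} := by
  classical
  obtain ⟨x₀, hx₀, γ, a, b, hab, hγ, hγa, hγb⟩ := h
  rw [mem_singleton_iff] at hx₀
  subst hx₀
  -- the curve stays in `U`
  have hU : ∀ t ∈ Icc a b, γ t ∈ 𝔠.opens := fun t ht ↦
    𝔠.mem_opens_of_isFutureCausalCurveOn hγ.isFutureCausalCurveOn (by rw [hγa]; exact x.2)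
      (by rw [hγb]; exact y.2) ht
  have hcont : ∀ t ∈ Icc a b, ContinuousAt γ t := fun t ht ↦ (hγ t ht).1.continuousAt
  -- its lift to `U`
  set δ : ℝ → 𝔠.opens := fun t ↦ if h : γ t ∈ 𝔠.opens then ⟨γ t, h⟩ else x with hδ
  have hδval : ∀ t ∈ Icc a b, (δ t : 𝒟.carrier) = γ t := fun t ht ↦ by
    simp only [hδ, dif_pos (hU t ht)]
  have hδev : ∀ t ∈ Icc a b, (Subtype.val ∘ δ) =ᶠ[𝓝 t] γ := fun t ht ↦ by
    have hmem : γ ⁻¹' (𝔠.opens : Set 𝒟.carrier) ∈ 𝓝 t :=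
      (hcont t ht).preimage_mem_nhds (𝔠.opens.2.mem_nhds (hU t ht))
    filter_upwards [hmem] with t' ht'
    simp only [comp_apply, hδ, dif_pos (show γ t' ∈ 𝔠.opens from ht')]
  have hδt : (𝒟.metric.restrict PseudoRiemannianMetric.contMDiff_restrict_holds 𝔠.opens).IsFutureTimelikeCurveOn
      (𝒟.timeOrientation.restrict PseudoRiemannianMetric.contMDiff_restrict_holds
        𝒟.timeOrientation.contMDiff_restrict_holds 𝔠.opens) δ (Icc a b) := by
    rw [LorentzianMetric.isFutureTimelikeCurveOn_restrict_iff]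
    intro t ht
    obtain ⟨hd, h1, h2⟩ := hγ t ht
    have hveq : velocity (𝓡 (k + 1)) (Subtype.val ∘ δ) t = velocity (𝓡 (k + 1)) γ t :=
      DFunLike.congr_fun (hδev t ht).mfderiv_eq (1 : ℝ)
    refine ⟨(hδev t ht).mdifferentiableAt_iff.2 hd, ?_, ?_⟩
    · change 𝒟.metric.val (δ t : 𝒟.carrier) (velocity (𝓡 (k + 1)) (Subtype.val ∘ δ) t)
        (velocity (𝓡 (k + 1)) (Subtype.val ∘ δ) t) < 0
      rw [hveq, hδval t ht]
      exact h1
    · change (𝒟.metric.val (δ t : 𝒟.carrier) (velocity (𝓡 (k + 1)) (Subtype.val ∘ δ) t)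
          (velocity (𝓡 (k + 1)) (Subtype.val ∘ δ) t) ≤ 0 ∧
            velocity (𝓡 (k + 1)) (Subtype.val ∘ δ) t ≠ 0) ∧
        𝒟.metric.val (δ t : 𝒟.carrier) (𝒟.timeOrientation.vectorField (δ t : 𝒟.carrier))
          (velocity (𝓡 (k + 1)) (Subtype.val ∘ δ) t) < 0
      rw [hveq, hδval t ht]
      exact h2
  -- push forward along `ψ`
  have hψd : MDifferentiable (𝓡 (k + 1)) (𝓡 (k + 1)) 𝔠.map := 𝔠.contMDiff_map.mdifferentiable (by simp)
  have hψγ := hδt.comp_isIsometricImmersion hψd 𝔠.preservesTimeOrientation 𝔠.isIsometricImmersion.2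
  have hδa : δ a = x := Subtype.ext ((hδval a (left_mem_Icc.2 hab.le)).trans hγa)
  have hδb : δ b = y := Subtype.ext ((hδval b (right_mem_Icc.2 hab.le)).trans hγb)
  exact ⟨𝔠.map x, rfl, 𝔠.map ∘ δ, a, b, hab, hψγ, by rw [comp_apply, hδa], by rw [comp_apply, hδb]⟩

/-- The range of `ψ⁻¹ : ψ(U) → M` is `U`. [folklore] -/
theorem range_symmMap : range 𝔠.symmMap = (𝔠.opens : Set 𝒟.carrier) := by
  ext q
  constructor
  · rintro ⟨z, rfl⟩
    exact 𝔠.symmMap_mem z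
  · intro hq
    exact ⟨⟨𝔠.map ⟨q, hq⟩, ⟨q, hq⟩, rfl⟩, 𝔠.symmMap_map ⟨q, hq⟩⟩

variable {𝔠}

/-- **Corresponding pairs are symmetric**: if `p ∈ ∂U` and `p' ∈ ∂ψ(U)` correspond for
`(U, ψ)`, then `p'` and `p` correspond for the symmetric common development `(ψ(U), ψ⁻¹)`
(`CommonDevelopment.symm`). Sbierski 2016, §3.2, Def. 11 with Remark 3 (2).
[cite: Sbierski2016AHP, §3.2, Def. 11 (arXiv numbering)] -/
theorem IsCorrespondingPair.symm {p : 𝒟.carrier} {p' : 𝒟'.carrier}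
    (h : 𝔠.IsCorrespondingPair p p') : 𝔠.symm.IsCorrespondingPair p' p := by
  refine ⟨?_, ?_, fun V' hV' V hV ↦ ?_⟩
  · show p' ∈ frontier (𝔠.rangeOpens : Set 𝒟'.carrier)
    rw [coe_rangeOpens]
    exact h.2.1
  · change p ∈ frontier (range 𝔠.symmMap)
    rw [range_symmMap]
    exact h.1
  · obtain ⟨y, hyV, hyV'⟩ := h.2.2 V hV V' hV'
    refine ⟨⟨𝔠.map y, y, rfl⟩, hyV', ?_⟩
    show 𝔠.symmMap ⟨𝔠.map y, y, rfl⟩ ∈ V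
    rw [𝔠.symmMap_map]
    exact hyV

/-- **Sbierski's first step: `ψ(I⁻(p) ∩ U) ⊆ I⁻(p')`.** Let `p`, `p'` be corresponding boundary
points and assume the causal futures of points of `M'` are closed (global hyperbolicity of `M'`,
O'Neill's Lemma 14.22). If `q ∈ U` and `q ≪ p`, then `ψ q ≪ p'`. Printed proof: for `t' ≫ p'`,
the neighbourhoods `I⁺(q) ∋ p` and `I⁻(t') ∋ p'` contain `y ∈ U` and `ψ y`, so
`ψ q ≪ ψ y ≪ t'`; letting `t' → p'` and using the closedness of `≤`, `ψ q ≤ p'`; applied to an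
intermediate `q ≪ s ≪ p` (which lies in `U` by causal convexity) this gives `ψ q ≪ ψ s ≤ p'`,
hence `ψ q ≪ p'` by push-up. [cite: Sbierski2016AHP, §3.2, proof of Prop. 13 (arXiv numbering)] -/
theorem IsCorrespondingPair.mem_chronologicalFuture_map
    (hJ' : ∀ x' : 𝒟'.carrier, IsClosed (𝒟'.metric.causalFuture 𝒟'.timeOrientation {x'}))
    {p : 𝒟.carrier} {p' : 𝒟'.carrier} (h : 𝔠.IsCorrespondingPair p p') {q : 𝔠.opens}
    (hq : p ∈ 𝒟.metric.chronologicalFuture 𝒟.timeOrientation {(q : 𝒟.carrier)}) :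
    p' ∈ 𝒟'.metric.chronologicalFuture 𝒟'.timeOrientation {𝔠.map q} := by
  have hn2 : (2 : ℕ∞ω) ≤ ∞ := WithTop.coe_le_coe.mpr le_top
  have hn1 : (1 : ℕ∞ω) ≤ ∞ := le_trans one_le_two hn2
  -- Step 1: `s ≪ p`, `s ∈ U` ⇒ `ψ s ≤ p'`
  have hle : ∀ s : 𝔠.opens,
      p ∈ 𝒟.metric.chronologicalFuture 𝒟.timeOrientation {(s : 𝒟.carrier)} →
        p' ∈ 𝒟'.metric.causalFuture 𝒟'.timeOrientation {𝔠.map s} := by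
    intro s hs
    have hcl : closure (𝒟'.metric.chronologicalFuture 𝒟'.timeOrientation {p'}) ⊆
        𝒟'.metric.causalFuture 𝒟'.timeOrientation {𝔠.map s} := by
      refine (hJ' _).closure_subset_iff.2 fun t' ht' ↦ ?_
      -- `I⁺(s) ∋ p` and `I⁻(t') ∋ p'` are neighbourhoods
      have hV : 𝒟.metric.chronologicalFuture 𝒟.timeOrientation {(s : 𝒟.carrier)} ∈ 𝓝 p :=
        (LorentzianMetric.isOpen_chronologicalFuture_of_boundaryless _ _ _).mem_nhds hs
      have hV' : 𝒟'.metric.chronologicalPast 𝒟'.timeOrientation {t'} ∈ 𝓝 p' :=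
        (LorentzianMetric.isOpen_chronologicalPast_of_boundaryless _ _ _).mem_nhds
          (LorentzianMetric.mem_chronologicalPast_of_mem_chronologicalFuture ht')
      obtain ⟨y, hyV, hyV'⟩ := h.2.2 _ hV _ hV'
      -- `ψ s ≪ ψ y ≪ t'`
      have h1 : 𝔠.map y ∈ 𝒟'.metric.chronologicalFuture 𝒟'.timeOrientation {𝔠.map s} :=
        𝔠.map_mem_chronologicalFuture_map hyV
      have h2 : t' ∈ 𝒟'.metric.chronologicalFuture 𝒟'.timeOrientation {𝔠.map y} :=
        LorentzianMetric.mem_chronologicalFuture_of_mem_chronologicalPast hyV'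
      exact LorentzianMetric.chronologicalFuture_subset_causalFuture _ _ _
        (LorentzianMetric.mem_chronologicalFuture_trans h1 h2)
    exact hcl (LorentzianMetric.subset_closure_chronologicalFuture (g := 𝒟'.metric)
      (τ := 𝒟'.timeOrientation) {p'} rfl)
  -- Step 2: an intermediate point `q ≪ s ≪ p`, in `U` by causal convexity
  obtain ⟨q₀, hq₀, γ, a, b, hab, hγ, hγa, hγb⟩ := hq
  rw [mem_singleton_iff] at hq₀
  subst hq₀
  set m : ℝ := (a + b) / 2 with hm
  have ham : a < m := by rw [hm]; linarith
  have hmb : m < b := by rw [hm]; linarith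
  have hqs : γ m ∈ 𝒟.metric.chronologicalFuture 𝒟.timeOrientation {γ a} :=
    ⟨γ a, rfl, γ, a, m, ham, hγ.mono (Icc_subset_Icc_right hmb.le), rfl, rfl⟩
  have hsp : p ∈ 𝒟.metric.chronologicalFuture 𝒟.timeOrientation {γ m} := by
    rw [← hγb]
    exact ⟨γ m, rfl, γ, m, b, hmb, hγ.mono (Icc_subset_Icc_left ham.le), rfl, rfl⟩
  have hsU : γ m ∈ 𝔠.opens := by
    refine 𝒟.isCauchyHypersurface.chronologicalFuture_inter_chronologicalPast_subset_opens hn2 _ _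
      𝔠.isCauchyHypersurface (q := γ a) (p := p) (by rw [hγa]; exact q.2)
      (frontier_subset_closure h.1) ⟨hqs, ?_⟩
    exact LorentzianMetric.mem_chronologicalPast_of_mem_chronologicalFuture hsp
  -- Step 3: `ψ q ≪ ψ s ≤ p'`
  have h3 : p' ∈ 𝒟'.metric.causalFuture 𝒟'.timeOrientation {𝔠.map ⟨γ m, hsU⟩} := hle _ hsp
  have h4 : 𝔠.map ⟨γ m, hsU⟩ ∈ 𝒟'.metric.chronologicalFuture 𝒟'.timeOrientation {𝔠.map q} := by
    refine 𝔠.map_mem_chronologicalFuture_map ?_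
    show γ m ∈ 𝒟.metric.chronologicalFuture 𝒟.timeOrientation {(q : 𝒟.carrier)}
    rw [← hγa]
    exact hqs
  exact LorentzianMetric.mem_chronologicalFuture_of_mem_chronologicalFuture_of_mem_causalFuture hn1 h4 h3

end CauchyDevelopment.CommonDevelopment

end Developments

end Literature.Geometry.Lorentzian

end
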